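import Summits.BirchSwinnertonDyer.BirchSwinnertonDyer.Theses.EisensteinPrimes
import Summits.BirchSwinnertonDyer.BirchSwinnertonDyer.Theorems.Rank1ResidualX1Isogeny
import Summits.BirchSwinnertonDyer.Rank1Residual.WAll.AltClosersX1DeepWitness
import Literature.NumberTheory.EllipticCurves.Rank1Residual.ClassX1Isogeny
import HarnessLib

/-!
# Crux `MazurMCOnX1RankZero` (route `EisensteinPrimes`, rung K5, item stmt-BirchSwinnertonDyer-19035):
# the line certificate of the skeleton of record `deepwitness`, on the fully-qualified crux type,
# its residue exactness, and the per-pair door in the crux's own currency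

HONEST FRAMING (cell `bsd-eis`, home `run/shared/lean/pub/bsd-eis/`, seat `bsd-eis-k5-c5` gen 4;
FULL-BSD rank-≤1 programme, ladder row A3 = class X1 ∩ {r_an = 0}: good ANOMALOUS Eisenstein prime
`p > 2`, `E[p]` reducible, parity type A forced by the class clause). THEOREMS ONLY; nothing here
closes the item, nothing is booked, no fact is restated, every input is a NAMED hypothesis. The crux
`MazurMCOnX1RankZero := ∀ W p, ClassX1 W p → W.analyticRank = 0 → MazurMainConjecture W p` is OPEN in
the refereed record on this leaf (Greenberg–Vatsal 2000 Thm. (1.3) is the GV-parity type;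
Castella–Grossi–Skinner 2025 Thm. A is non-anomalous) and CLAIMED only by the preprint Keller–Yin
arXiv:2402.12781v2 (unlabeled Thm. 3.0.10).

WHAT THIS FILE RECORDS. The skeleton of record on the item since 2026-08-27T09:35Z is the line
`deepwitness` (cell `bsd-wall`, seat `bsd-wall-eis` g2; `ledger skeleton check` sha 3018ca05…): two
stubs, `stub_published` (eight refereed inputs BY NAME, one conjunction) and `stub_deepWitness` (at
every rank-`0` X1 pair some globally minimal member `W'` of the `ℚ`-isogeny class carries a DEEP
Ш-WITNESS: `#Ш_an(W') = q`, `ord_p q ≤ 2k`, `p^(2k-1) ∣ #Ш(W')` for some `k`), composed through the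
`WAll`-side closer `Rank1Residual.WAll.x1RankZero_bsdp_of_deepWitness` (ty-2, p517824) and this
seat's converse chain `mazurMCOnX1RankZero_iff_forall_bsdp` (g0, p417726; =
`Rank1ResidualX1Converse.mazurMainConjectureOnX1_rankZero_iff`). The composition lives in a
`Lines/` skeleton, not in a `Theorems` file; the cell's standing rule (1) wants every closer /
supporting theorem to state the FULLY-QUALIFIED item type. Hence:

* §1 `X1.bsdp_of_deepWitnessAt`, `mazurMainConjecture_of_deepWitnessAt` — the PER-PAIR door at any
  depth `k`: one deep Ш-witness on ONE globally minimal member `W' ∼ W` of the class of a rank-`0` X1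
  pair `(W, p)` gives `BSD(W, p)` (Kato–Wuthrich `#Ш ∣ #Ш_an` + Cassels–Tate squareness at `W'`,
  Cassels' isogeny invariance back to `W`) and then `Rank1ResidualX1Defs.MazurMainConjecture W p` —
  the CRUX's conclusion at that pair (Wuthrich Thm. 16 + Greenberg Thm. 4.1). This is what each of the
  149 row-A3 certificates of record (113 first `p`-isogeny descents `k = 1`, 11 second descents `k = 2`,
  the double-twist / twisted-descent cells) buys in Mazur's currency, by name, at its pair.
* §2 `mazurMCOnX1RankZero_of_deepWitness` — the LINE CERTIFICATE: the crux (route decl by name) from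
  the two registered stubs taken as hypotheses (`hCT hSha hGZK hmod hCas hW16 hGr hPar` = the eight
  conjuncts of `stub_published`; `hdeep` = `stub_deepWitness` verbatim).
* §3 `deepWitness_of_mazurMCOnX1RankZero`, `mazurMCOnX1RankZero_iff_deepWitness` — RESIDUE
  EXACTNESS on the crux type: granted the published inputs the crux IMPLIES the deep-witness cell
  (witness on the curve itself, `k = ⌈ord_p #Ш / 2⌉`; ty-2 `deepWitness_of_x1RankZeroStatement`), so
  class-wide the registered stub is neither weaker nor stronger than what is missing — the language
  switch has teeth PER CELL only (every instance is a finite, refereeable computation);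
  `deepWitnessAt_of_mazurMainConjecture` is the per-pair form.
* §4 `mazurMCOnX1RankZero_of_published_of_deepWitness` — the same certificate with `stub_published`
  as ONE conjunction hypothesis, literally the registered stub signatures (for the gate's by-name
  matching of the line).

References: `Rank1Residual/WAll/AltClosersX1DeepWitness.lean` (ty-2), `Theorems/Rank1ResidualX1Isogeny.lean`,
`Literature/…/Rank1Residual/X1RankZeroCertificate.lean` (`X1.bsdp_of_casselsTate_of_pow_dvd`),
`Theorems/EisensteinPrimesMazurMCOnX1RankZero.lean` §2 (not imported: this file imports the route
file and route-independent modules only, cell build rule 2026-08-26T19:10Z). [cite: Wuthrich2014, Thm. 16 (p. 397) and Prop. 21 (p. 400)]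
[cite: GreenbergLNM1716, Thm. 4.1] [cite: SilvermanAEC2009, Thm. X.4.14] [cite: MilneADT2006, Thm. I.7.3]
[cite: Miller2011LMS, Def. 1.1 (arXiv:1010.2431 p. 3)] [cite: CreutzMiller2012, Thm. 1.1]
-/

noncomputable section

open scoped Classical

open WeierstrassCurve Literature.NumberTheory.EllipticCurves
  Literature.NumberTheory.EllipticCurves.ModularForms
  Literature.NumberTheory.EllipticCurves.Rank1Residual
  Literature.NumberTheory.EllipticCurves.Greenberg1999
  Summit.BirchSwinnertonDyer.BirchSwinnertonDyer.Theorems.Rank1ResidualX1Defs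
  Summit.BirchSwinnertonDyer.BirchSwinnertonDyer.Theorems.Rank1ResidualX1Converse
  Summit.BirchSwinnertonDyer.BirchSwinnertonDyer.Theorems.Rank1ResidualX1Isogeny
  Summit.BirchSwinnertonDyer.Rank1Residual
  Summit.BirchSwinnertonDyer.Rank1Residual.WAll

set_option linter.dupNamespace false
set_option autoImplicit false

namespace Summit.BirchSwinnertonDyer.BirchSwinnertonDyer.Theorems.EisensteinPrimesMazurMCOnX1RankZeroDeepWitness

/-! ## §1. The per-pair door at any depth `k`, in `BSD(E,p)` and in Mazur's currency -/

/-- **One deep Ш-witness on one member of the class ⇒ `BSD(E,p)` at a rank-`0` X1 pair.** For a rank-`0`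
X1 pair `(W, p)` and a globally minimal `W' ∼ W` with `#Ш_an(W') = q`, `ord_p q ≤ 2k` and
`p^(2k-1) ∣ #Ш(W')`: class X1 and the rank transport along the isogeny (`ClassX1.of_isIsogenous`,
Faltings), the lever `X1.bsdp_of_casselsTate_of_pow_dvd` gives `BSD(W', p)` (Kato–Wuthrich
`#Ш ∣ #Ш_an` + Cassels–Tate squareness force `ord_p #Ш(W') = ord_p q`), and Cassels' invariance
(`hCas`; `Ш(W')` finite and `L(W',1) ≠ 0` by GZK / modularity) carries it back to `W`. Granted the
PUBLISHED named facts `hCT` (Cassels–Tate pairing), `hSha` (Wuthrich 2014 Prop. 21), `hGZK`, `hmod`,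
`hCas` (Milne ADT I.7.3). [cite: Wuthrich2014, Prop. 21 (p. 400)] [cite: SilvermanAEC2009, Thm. X.4.14]
[cite: MilneADT2006, Thm. I.7.3] [cite: Knapp1993, Thm. 11.67 (PDF p. 281)] -/
theorem X1.bsdp_of_deepWitnessAt (hCT : exists_casselsTate_pairing (K := ℚ))
    (hSha : Wuthrich2014.sha_dvd_analyticSha) (hGZK : rank_eq_analyticRank_of_analyticRank_le_one)
    (hmod : hasEntireLFunction_rat) (hCas : bsdRHS_eq_of_isIsogenous)
    (W W' : WeierstrassCurve ℚ) [W.IsElliptic] [W'.IsElliptic] [W.IsGloballyMinimal]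
    [W'.IsGloballyMinimal] (hiso : IsIsogenous W W') (p : ℕ) [Fact p.Prime]
    (hX1 : ClassX1 W p) (hr0 : W.analyticRank = 0)
    {q : ℚ} (hq : shaAn W' = (q : ℂ)) {k : ℕ} (hv : padicValRat p q ≤ 2 * k)
    (hdvd : p ^ (2 * k - 1) ∣ W'.shaOrder) : BSDp W p := by
  have hX1' : ClassX1 W' p := ClassX1.of_isIsogenous hiso hX1
  have hr0' : W'.analyticRank = 0 := (analyticRank_eq_of_isIsogenous' hiso) ▸ hr0
  have h' : BSDp W' p :=
    X1.bsdp_of_casselsTate_of_pow_dvd hCT hSha hGZK hmod W' p (by omega) hX1' hr0' hq hv hdvd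
  obtain ⟨-, hfin'⟩ := hGZK W' (by omega)
  have hL' : W'.entireLFunction 1 ≠ 0 := (W'.analyticRank_eq_zero_iff_holds (hmod W')).mp hr0'
  have hlead : W'.leadingLCoeff ≠ 0 := by
    rwa [W'.leadingLCoeff_eq_of_analyticRank_eq_zero hr0']
  exact Wuthrich2014.bsdp_of_isIsogenous hCas hiso hfin' hlead h'

/-- **One deep Ш-witness on one member of the class ⇒ Mazur's main conjecture at the pair** — the
CRUX's conclusion `Rank1ResidualX1Defs.MazurMainConjecture W p` (every datum `(κ, γ, f, ϖ, D)`, Néron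
normalisation) at a rank-`0` X1 pair `(W, p)`, from §1's `BSD(W, p)` through the converse chain
Wuthrich Thm. 16 (`hW16`) + Greenberg Thm. 4.1 (`hGr`) + modularity (`hPar`) + GZK
(`Rank1ResidualX1Converse.mazurMainConjecture_iff_bsdp`). This is, by name, what one row-A3 certificate
(`k = 0`: `p ∤ #Ш_an`; `k = 1`: one `p`-isogeny descent; `k = 2`: a second descent) buys for the crux AT
ITS PAIR — at type-A anomalous pairs, outside Greenberg–Vatsal 2000 and Castella–Grossi–Skinner 2025.
Per pair; NOT a class theorem. [cite: Wuthrich2014, Thm. 16 (p. 397) and Prop. 21 (p. 400)]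
[cite: GreenbergLNM1716, Thm. 4.1] [cite: SilvermanAEC2009, Thm. X.4.14] [cite: MilneADT2006, Thm. I.7.3] -/
theorem mazurMainConjecture_of_deepWitnessAt (hCT : exists_casselsTate_pairing (K := ℚ))
    (hSha : Wuthrich2014.sha_dvd_analyticSha) (hGZK : rank_eq_analyticRank_of_analyticRank_le_one)
    (hmod : hasEntireLFunction_rat) (hCas : bsdRHS_eq_of_isIsogenous)
    (hW16 : Wuthrich2014.charIdeal_dvd_padicLFunction) (hGr : greenberg_charValue_rankZero)
    (hPar : nonempty_modularParametrizationData)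
    (W W' : WeierstrassCurve ℚ) [W.IsElliptic] [W'.IsElliptic] [W.IsGloballyMinimal]
    [W'.IsGloballyMinimal] (hiso : IsIsogenous W W') (p : ℕ) [Fact p.Prime]
    (hX1 : ClassX1 W p) (hr0 : W.analyticRank = 0)
    {q : ℚ} (hq : shaAn W' = (q : ℂ)) {k : ℕ} (hv : padicValRat p q ≤ 2 * k)
    (hdvd : p ^ (2 * k - 1) ∣ W'.shaOrder) : MazurMainConjecture W p :=
  (mazurMainConjecture_iff_bsdp hW16 hGr hPar hGZK W p hX1 hr0).mpr
    (X1.bsdp_of_deepWitnessAt hCT hSha hGZK hmod hCas W W' hiso p hX1 hr0 hq hv hdvd)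

/-- **… and at the witnessing member too**: the same certificate gives Mazur's main conjecture at
`(W', p)` (isogeny invariance of the main conjecture on X1 ∩ {r = 0},
`Rank1ResidualX1Isogeny.mazurMainConjecture_iff_of_isIsogenous_of_analyticRank_eq_zero`).
[cite: Wuthrich2014, Thm. 16 (p. 397), Lemma 17] [cite: GreenbergLNM1716, Thm. 4.1] [cite: MilneADT2006, Thm. I.7.3] -/
theorem mazurMainConjecture_pair_of_deepWitnessAt (hCT : exists_casselsTate_pairing (K := ℚ))
    (hSha : Wuthrich2014.sha_dvd_analyticSha) (hGZK : rank_eq_analyticRank_of_analyticRank_le_one)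
    (hmod : hasEntireLFunction_rat) (hCas : bsdRHS_eq_of_isIsogenous)
    (hW16 : Wuthrich2014.charIdeal_dvd_padicLFunction) (hGr : greenberg_charValue_rankZero)
    (hPar : nonempty_modularParametrizationData)
    (W W' : WeierstrassCurve ℚ) [W.IsElliptic] [W'.IsElliptic] [W.IsGloballyMinimal]
    [W'.IsGloballyMinimal] (hiso : IsIsogenous W W') (p : ℕ) [Fact p.Prime]
    (hX1 : ClassX1 W p) (hr0 : W.analyticRank = 0)
    {q : ℚ} (hq : shaAn W' = (q : ℂ)) {k : ℕ} (hv : padicValRat p q ≤ 2 * k)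
    (hdvd : p ^ (2 * k - 1) ∣ W'.shaOrder) : MazurMainConjecture W p ∧ MazurMainConjecture W' p := by
  have h : MazurMainConjecture W p :=
    mazurMainConjecture_of_deepWitnessAt hCT hSha hGZK hmod hCas hW16 hGr hPar W W' hiso p hX1 hr0 hq
      hv hdvd
  exact ⟨h, (mazurMainConjecture_iff_of_isIsogenous_of_analyticRank_eq_zero hW16 hGr hPar hmod hGZK
    hCas W W' hiso p hX1 hr0).mp h⟩

/-! ## §2. The line certificate `deepwitness` on the fully-qualified crux type -/

/-- **LINE CERTIFICATE (`deepwitness`, skeleton of record 3018ca05…): the crux `MazurMCOnX1RankZero`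
from the two registered stubs taken as hypotheses.** `hCT … hPar` are the eight conjuncts of
`stub_published` (Cassels–Tate pairing; Wuthrich 2014 Prop. 21; Gross–Zagier–Kolyvagin; modularity
(entire `L`); Cassels' invariance; Wuthrich 2014 Thm. 16; Greenberg 1999 Thm. 4.1; modular
parametrisation), `hdeep` is `stub_deepWitness` verbatim. Proof = the skeleton's `MazurMCOnX1RankZero_of`:
`BSD(E,p)` at every rank-`0` X1 pair by `Rank1Residual.WAll.x1RankZero_bsdp_of_deepWitness` (ty-2),
then the converse chain `Rank1ResidualX1Converse.mazurMainConjectureOnX1_rankZero_iff` (=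
`mazurMCOnX1RankZero_iff_forall_bsdp` of this seat's g0 file, re-derived here route-independently so
that this file imports the route file and route-free modules only). CONDITIONAL; the item stays open
(class-wide `hdeep` is the crux in certificate currency, §3).
[cite: Wuthrich2014, Thm. 16 (p. 397) and Prop. 21 (p. 400)] [cite: GreenbergLNM1716, Thm. 4.1]
[cite: SilvermanAEC2009, Thm. X.4.14] [cite: MilneADT2006, Thm. I.7.3] -/
theorem mazurMCOnX1RankZero_of_deepWitness (hCT : exists_casselsTate_pairing (K := ℚ))
    (hSha : Wuthrich2014.sha_dvd_analyticSha) (hGZK : rank_eq_analyticRank_of_analyticRank_le_one)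
    (hmod : hasEntireLFunction_rat) (hCas : bsdRHS_eq_of_isIsogenous)
    (hW16 : Wuthrich2014.charIdeal_dvd_padicLFunction) (hGr : greenberg_charValue_rankZero)
    (hPar : nonempty_modularParametrizationData)
    (hdeep : ∀ (W : WeierstrassCurve ℚ) [W.IsElliptic] [W.IsGloballyMinimal] (p : ℕ)
      [Fact p.Prime], ClassX1 W p → W.analyticRank = 0 →
      ∃ (W' : WeierstrassCurve ℚ) (_ : W'.IsElliptic) (_ : W'.IsGloballyMinimal), IsIsogenous W W' ∧
        ∃ q : ℚ, shaAn W' = (q : ℂ) ∧ ∃ k : ℕ, padicValRat p q ≤ 2 * k ∧ p ^ (2 * k - 1) ∣ W'.shaOrder) :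
    Summit.BirchSwinnertonDyer.BirchSwinnertonDyer.Theses.EisensteinPrimes.MazurMCOnX1RankZero :=
  (mazurMainConjectureOnX1_rankZero_iff hW16 hGr hPar hGZK).mpr
    (fun W _ _ p _ hX hr0 ↦ x1RankZero_bsdp_of_deepWitness hCT hSha hGZK hmod hCas hdeep W p hX hr0)

/-! ## §3. Residue exactness: the crux hands the deep-witness cell back -/

/-- **Per pair: Mazur's main conjecture at a rank-`0` X1 pair ⇒ a deep Ш-witness on the curve itself**
(`W' = W`, `q = #Ш_an(W)`, `k = ⌈ord_p #Ш(W) / 2⌉`): `MazurMainConjecture W p ⇒ BSD(W,p)`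
(`Rank1ResidualX1Converse.mazurMainConjecture_iff_bsdp`, forward = the CGLS glue: Wuthrich Thm. 16,
Greenberg Thm. 4.1, modularity, GZK), then ty-2's `exists_pow_dvd_shaOrder_of_bsdp` (`Ш` finite by GZK).
[cite: GreenbergLNM1716, Thm. 4.1] [cite: Wuthrich2014, Thm. 16 (p. 397)] [cite: Miller2011LMS, Def. 1.1 (arXiv:1010.2431 p. 3)] -/
theorem deepWitnessAt_of_mazurMainConjecture (hW16 : Wuthrich2014.charIdeal_dvd_padicLFunction)
    (hGr : greenberg_charValue_rankZero) (hPar : nonempty_modularParametrizationData)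
    (hGZK : rank_eq_analyticRank_of_analyticRank_le_one)
    (W : WeierstrassCurve ℚ) [iE : W.IsElliptic] [iM : W.IsGloballyMinimal] (p : ℕ) [Fact p.Prime]
    (hX1 : ClassX1 W p) (hr0 : W.analyticRank = 0) (h : MazurMainConjecture W p) :
    ∃ (W' : WeierstrassCurve ℚ) (_ : W'.IsElliptic) (_ : W'.IsGloballyMinimal), IsIsogenous W W' ∧
      ∃ q : ℚ, shaAn W' = (q : ℂ) ∧ ∃ k : ℕ, padicValRat p q ≤ 2 * k ∧ p ^ (2 * k - 1) ∣ W'.shaOrder := by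
  have hB : BSDp W p := (mazurMainConjecture_iff_bsdp hW16 hGr hPar hGZK W p hX1 hr0).mp h
  obtain ⟨-, hfin⟩ := hGZK W (by omega)
  have hB' := hB
  obtain ⟨-, -, q, hq, -⟩ := hB'
  exact ⟨W, iE, iM, isIsogenous_self W, q, hq, exists_pow_dvd_shaOrder_of_bsdp W p hfin hB hq⟩

/-- **Class-wide: the crux IMPLIES the deep-witness cell** (granted Wuthrich Thm. 16, Greenberg Thm. 4.1,
modular parametrisation, GZK): pair by pair through `deepWitnessAt_of_mazurMainConjecture` (the
witness is the curve itself; = ty-2's `deepWitness_of_x1RankZeroStatement` composed with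
`mazurMCOnX1RankZero_iff_statement`, re-derived route-independently). So the registered stub
`stub_deepWitness` is NECESSARY for the crux — nothing weaker closes it.
[cite: GreenbergLNM1716, Thm. 4.1] [cite: Wuthrich2014, Thm. 16 (p. 397)] [cite: Miller2011LMS, Def. 1.1 (arXiv:1010.2431 p. 3)] -/
theorem deepWitness_of_mazurMCOnX1RankZero (hW16 : Wuthrich2014.charIdeal_dvd_padicLFunction)
    (hGr : greenberg_charValue_rankZero) (hPar : nonempty_modularParametrizationData)
    (hGZK : rank_eq_analyticRank_of_analyticRank_le_one)
    (h : Summit.BirchSwinnertonDyer.BirchSwinnertonDyer.Theses.EisensteinPrimes.MazurMCOnX1RankZero) :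
    ∀ (W : WeierstrassCurve ℚ) [W.IsElliptic] [W.IsGloballyMinimal] (p : ℕ)
      [Fact p.Prime], ClassX1 W p → W.analyticRank = 0 →
      ∃ (W' : WeierstrassCurve ℚ) (_ : W'.IsElliptic) (_ : W'.IsGloballyMinimal), IsIsogenous W W' ∧
        ∃ q : ℚ, shaAn W' = (q : ℂ) ∧ ∃ k : ℕ, padicValRat p q ≤ 2 * k ∧ p ^ (2 * k - 1) ∣ W'.shaOrder :=
  fun W _ _ p _ hX1 hr0 ↦ deepWitnessAt_of_mazurMainConjecture hW16 hGr hPar hGZK W p hX1 hr0 (h W p hX1 hr0)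

/-- **RESIDUE EXACTNESS of the line `deepwitness`**: granted the eight PUBLISHED inputs of
`stub_published`, the crux `MazurMCOnX1RankZero` is EQUIVALENT to its registered stub `stub_deepWitness`.
Class-wide the stub is the crux in certificate currency — neither weaker nor stronger; the language
switch has teeth only per cell (every instance is a finite computation: §1).
[cite: Wuthrich2014, Thm. 16 (p. 397) and Prop. 21 (p. 400)] [cite: GreenbergLNM1716, Thm. 4.1]
[cite: SilvermanAEC2009, Thm. X.4.14] [cite: MilneADT2006, Thm. I.7.3] [cite: Miller2011LMS, Def. 1.1 (arXiv:1010.2431 p. 3)] -/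
theorem mazurMCOnX1RankZero_iff_deepWitness (hCT : exists_casselsTate_pairing (K := ℚ))
    (hSha : Wuthrich2014.sha_dvd_analyticSha) (hGZK : rank_eq_analyticRank_of_analyticRank_le_one)
    (hmod : hasEntireLFunction_rat) (hCas : bsdRHS_eq_of_isIsogenous)
    (hW16 : Wuthrich2014.charIdeal_dvd_padicLFunction) (hGr : greenberg_charValue_rankZero)
    (hPar : nonempty_modularParametrizationData) :
    Summit.BirchSwinnertonDyer.BirchSwinnertonDyer.Theses.EisensteinPrimes.MazurMCOnX1RankZero ↔
    ∀ (W : WeierstrassCurve ℚ) [W.IsElliptic] [W.IsGloballyMinimal] (p : ℕ)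
      [Fact p.Prime], ClassX1 W p → W.analyticRank = 0 →
      ∃ (W' : WeierstrassCurve ℚ) (_ : W'.IsElliptic) (_ : W'.IsGloballyMinimal), IsIsogenous W W' ∧
        ∃ q : ℚ, shaAn W' = (q : ℂ) ∧ ∃ k : ℕ, padicValRat p q ≤ 2 * k ∧ p ^ (2 * k - 1) ∣ W'.shaOrder :=
  ⟨deepWitness_of_mazurMCOnX1RankZero hW16 hGr hPar hGZK,
    mazurMCOnX1RankZero_of_deepWitness hCT hSha hGZK hmod hCas hW16 hGr hPar⟩

/-! ## §4. The certificate against the registered stub signatures literally -/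

/-- **The line `deepwitness` with its stubs LITERALLY as hypotheses**: `hpub` is the registered
signature of `stub_published` (one conjunction of the eight refereed inputs by name) and `hdeep` that of
`stub_deepWitness`; conclusion the route decl. This is the skeleton's `MazurMCOnX1RankZero_of` with the
two `sorry`-stubs replaced by hypotheses — the by-name line certificate for the gate and the desks.
[cite: Wuthrich2014, Thm. 16 (p. 397) and Prop. 21 (p. 400)] [cite: GreenbergLNM1716, Thm. 4.1]
[cite: SilvermanAEC2009, Thm. X.4.14] [cite: MilneADT2006, Thm. I.7.3] -/
theorem mazurMCOnX1RankZero_of_published_of_deepWitness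
    (hpub : exists_casselsTate_pairing (K := ℚ) ∧ Wuthrich2014.sha_dvd_analyticSha ∧
      rank_eq_analyticRank_of_analyticRank_le_one ∧ hasEntireLFunction_rat ∧ bsdRHS_eq_of_isIsogenous ∧
      Wuthrich2014.charIdeal_dvd_padicLFunction ∧ greenberg_charValue_rankZero ∧
      nonempty_modularParametrizationData)
    (hdeep : ∀ (W : WeierstrassCurve ℚ) [W.IsElliptic] [W.IsGloballyMinimal] (p : ℕ)
      [Fact p.Prime], ClassX1 W p → W.analyticRank = 0 →
      ∃ (W' : WeierstrassCurve ℚ) (_ : W'.IsElliptic) (_ : W'.IsGloballyMinimal), IsIsogenous W W' ∧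
        ∃ q : ℚ, shaAn W' = (q : ℂ) ∧ ∃ k : ℕ, padicValRat p q ≤ 2 * k ∧ p ^ (2 * k - 1) ∣ W'.shaOrder) :
    Summit.BirchSwinnertonDyer.BirchSwinnertonDyer.Theses.EisensteinPrimes.MazurMCOnX1RankZero := by
  obtain ⟨hCT, hSha, hGZK, hmod, hCas, hW16, hGr, hPar⟩ := hpub
  exact mazurMCOnX1RankZero_of_deepWitness hCT hSha hGZK hmod hCas hW16 hGr hPar hdeep

/-- **… and the stubs are jointly EQUIVALENT to the crux given `stub_published`** (the conjunction form
of §3's residue exactness). [cite: Wuthrich2014, Thm. 16 (p. 397) and Prop. 21 (p. 400)]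
[cite: GreenbergLNM1716, Thm. 4.1] [cite: Miller2011LMS, Def. 1.1 (arXiv:1010.2431 p. 3)] -/
theorem mazurMCOnX1RankZero_iff_deepWitness_of_published
    (hpub : exists_casselsTate_pairing (K := ℚ) ∧ Wuthrich2014.sha_dvd_analyticSha ∧
      rank_eq_analyticRank_of_analyticRank_le_one ∧ hasEntireLFunction_rat ∧ bsdRHS_eq_of_isIsogenous ∧
      Wuthrich2014.charIdeal_dvd_padicLFunction ∧ greenberg_charValue_rankZero ∧
      nonempty_modularParametrizationData) :
    Summit.BirchSwinnertonDyer.BirchSwinnertonDyer.Theses.EisensteinPrimes.MazurMCOnX1RankZero ↔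
    ∀ (W : WeierstrassCurve ℚ) [W.IsElliptic] [W.IsGloballyMinimal] (p : ℕ)
      [Fact p.Prime], ClassX1 W p → W.analyticRank = 0 →
      ∃ (W' : WeierstrassCurve ℚ) (_ : W'.IsElliptic) (_ : W'.IsGloballyMinimal), IsIsogenous W W' ∧
        ∃ q : ℚ, shaAn W' = (q : ℂ) ∧ ∃ k : ℕ, padicValRat p q ≤ 2 * k ∧ p ^ (2 * k - 1) ∣ W'.shaOrder := by
  obtain ⟨hCT, hSha, hGZK, hmod, hCas, hW16, hGr, hPar⟩ := hpub
  exact mazurMCOnX1RankZero_iff_deepWitness hCT hSha hGZK hmod hCas hW16 hGr hPar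

end Summit.BirchSwinnertonDyer.BirchSwinnertonDyer.Theorems.EisensteinPrimesMazurMCOnX1RankZeroDeepWitness

end
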